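import Literature.MathematicalPhysics.QuantumFieldTheory.Balaban1983to89.Step

/-!
# `Balaban1983to89.B14Eq219Factorization` — CMP 119 (2.19) p. 258 in its printed n-ARY form: the factorization
# `𝐓_k(Z_k) = Π_{i=1}^{n} 𝐓_k(X_i)` over a disjoint decomposition `Z_k = X₁ ∪ … ∪ X_n`, and the independence of the order
# of the factors, DERIVED from the binary law and the commutation law of `Step.TkOps.Laws`

statement-level skeleton of published theorems with citation tags; proofs where landed; nothing here is a claim about the Yang–Mills mass gap

CITATION HEADER (lean-in-tree rule).  Source: T. Bałaban, *Convergent renormalization expansions for lattice gauge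
theories*, Commun. Math. Phys. **119**, 243–285 (1988), doi:10.1007/bf01217741 [Balaban1988Convergent] (cell paper
B14 = «[III]»; held `paper:balaban1988-cmp119-convergent-renormalization`, journal page = PDF page + 242; p. 258 read on
the text layer `p0016` and the x2 render `…-p016-x2.png`).  Mega-formalization `lit-balaban`, unit `lit-balaban-r11`
(CMP 119, B14 fold owner), SKELETON row **B14.Eq2.19** (the law rows B14.Eq2.20 = (2.20), B14.Eq2.22 = (2.22) are the
neighbours; the operations themselves, (2.21), are row B14.Eq2.21).

THE PRINTED TEXT (p. 258 [PDF 16], verbatim).  *"The last large field region is Z_k, and 𝐓_k is supported in it, more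
exactly in a neighbourhood of it. If Z_k is represented as a union of disjoint regions, e.g. as a union of connected
components, Z_k = X₁ ∪ … ∪ X_n, X_i ∩ X_j = ∅ for i ≠ j, then
  𝐓_k(Z_k) = Π_{i=1}^{n} 𝐓_k(X_i).   (2.19)
The operations corresponding to disjoint regions commute, i.e., 𝐓_k(X_i)𝐓_k(X_j) = 𝐓_k(X_j)𝐓_k(X_i)."*

THE CARRIER OF RECORD (pre-existing, BY NAME).  `Step.TkOps ι M` — the operations `𝐓_k(X)` as elements of an abstract
monoid `M` indexed by sub-regions `X ⊆ Z_k` of one ambient point type `ι` (print p. 254: *"the operations … are left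
undefined, only their basic general properties are formulated"*) — and its law predicate `Step.TkOps.Laws O k`, whose
fields `factor219` (BINARY factorization `𝐓_k(X ∪ Y) = 𝐓_k(X)𝐓_k(Y)` for disjoint `X, Y ⊆ Z_k`) and `comm219` (the
commutation sentence) type (2.19) in binary form.  This file derives the printed n-ary display from them.

WHAT IS PROVED (0 `sorry`; theorems only — the union `X₁ ∪ … ∪ X_n` of a list `l` of regions is `l.foldr (· ∪ ·) ∅`).
* `unionL_cons`, `mem_unionL`, `unionL_subset`, `disjoint_unionL` — list-union bookkeeping.
* **`factor219_list`** — for a non-empty list `X₁, …, X_n` of pairwise disjoint sub-regions of `Z_k`: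
  `𝐓_k(X₁ ∪ … ∪ X_n) = 𝐓_k(X₁) ⋯ 𝐓_k(X_n)` (ordered product); **`factor219`** — the printed case `Z_k = X₁ ∪ … ∪ X_n`:
  `𝐓_k(Z_k) = Π_{i=1}^{n} 𝐓_k(X_i)`.
* **`prod_perm`** — the product does not depend on the order of the factors (*"The operations corresponding to disjoint
  regions commute"*): for pairwise disjoint sub-regions of `Z_k`, any permutation of the list gives the same product
  (`List.Perm.prod_eq'` on the pairwise `Commute` supplied by `comm219`); `factor219_perm` combines the two.

NOT ASSERTED: that the concrete integral operators (2.21) satisfy the laws (row B14.Eq2.21; the instance CLASS is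
`TkOpsMarginal.LocalSystem.laws`), nor anything at `n = 0` (print's decomposition of `Z_k` is non-empty when `Z_k` is;
the binary laws do not force `𝐓_k(∅) = 1`).

## References
* [Balaban1988Convergent] T. Bałaban, Commun. Math. Phys. 119 (1988) 243–285, (2.19) p. 258.
-/

namespace Literature.MathematicalPhysics.QuantumFieldTheory.Balaban1983to89.B14.Eq219Factorization

open Literature.MathematicalPhysics.QuantumFieldTheory.Balaban1983to89
open Step

variable {ι : Type*} {M : Type*} [Monoid M]

/-- `X₁ ∪ … ∪ X_n` of a list of regions is written `l.foldr (· ∪ ·) ∅` (no new definition); on `X :: l` it is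
`X ∪ (l.foldr (· ∪ ·) ∅)`. [cite: Balaban1988Convergent, (2.19) p.258] -/
theorem unionL_cons (X : Set ι) (l : List (Set ι)) :
    (X :: l).foldr (· ∪ ·) (∅ : Set ι) = X ∪ l.foldr (· ∪ ·) (∅ : Set ι) := rfl

/-- Membership in `X₁ ∪ … ∪ X_n`. [cite: Balaban1988Convergent, (2.19) p.258] -/
theorem mem_unionL {x : ι} : ∀ {l : List (Set ι)}, x ∈ l.foldr (· ∪ ·) (∅ : Set ι) ↔ ∃ X ∈ l, x ∈ X
  | [] => by simp
  | X :: l => by simp [mem_unionL (l := l)]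

/-- If every `X_i ⊆ Z` then `X₁ ∪ … ∪ X_n ⊆ Z`. [cite: Balaban1988Convergent, (2.19) p.258] -/
theorem unionL_subset {l : List (Set ι)} {Z : Set ι} (h : ∀ X ∈ l, X ⊆ Z) : l.foldr (· ∪ ·) (∅ : Set ι) ⊆ Z := by
  intro x hx
  obtain ⟨X, hX, hxX⟩ := mem_unionL.mp hx
  exact h X hX hxX

/-- A region disjoint from every `X_i` is disjoint from their union. [cite: Balaban1988Convergent, (2.19) p.258] -/
theorem disjoint_unionL {Y : Set ι} {l : List (Set ι)} (h : ∀ X ∈ l, Disjoint Y X) : Disjoint Y (l.foldr (· ∪ ·) (∅ : Set ι)) := by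
  rw [Set.disjoint_left]
  intro x hxY hx
  obtain ⟨X, hX, hxX⟩ := mem_unionL.mp hx
  exact Set.disjoint_left.mp (h X hX) hxY hxX

/-- **(2.19) in its n-ary form, for sub-regions.**  For a non-empty list `X₁, …, X_n` of pairwise disjoint sub-regions of
the last large field region `Z_k`, the binary factorization law gives `𝐓_k(X₁ ∪ … ∪ X_n) = 𝐓_k(X₁)𝐓_k(X₂) ⋯ 𝐓_k(X_n)`
(ordered product, by induction on `n`). [cite: Balaban1988Convergent, (2.19) p.258] -/
theorem factor219_list (O : TkOps ι M) {k : ℕ} (hL : O.Laws k) :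
    ∀ (l : List (Set ι)), l ≠ [] → (∀ X ∈ l, X ⊆ O.Z k) → l.Pairwise Disjoint →
      O.T k (l.foldr (· ∪ ·) (∅ : Set ι)) = (l.map (O.T k)).prod
  | [], h, _, _ => absurd rfl h
  | [X], _, _, _ => by simp
  | X :: Y :: l, _, hsub, hdis => by
    have hsub' : ∀ W ∈ Y :: l, W ⊆ O.Z k := fun W hW => hsub W (List.mem_cons_of_mem X hW)
    have hdis' : (Y :: l).Pairwise Disjoint := (List.pairwise_cons.mp hdis).2
    have hXd : ∀ W ∈ Y :: l, Disjoint X W := (List.pairwise_cons.mp hdis).1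
    have ih := factor219_list O hL (Y :: l) (List.cons_ne_nil Y l) hsub' hdis'
    rw [unionL_cons, List.map_cons, List.prod_cons, ← ih]
    exact hL.factor219 X ((Y :: l).foldr (· ∪ ·) (∅ : Set ι)) (hsub X (by simp)) (unionL_subset hsub') (disjoint_unionL hXd)

/-- **(2.19) as printed.**  *"If Z_k is represented as a union of disjoint regions … Z_k = X₁ ∪ … ∪ X_n, X_i ∩ X_j = ∅ for
i ≠ j, then 𝐓_k(Z_k) = Π_{i=1}^{n} 𝐓_k(X_i)."* [cite: Balaban1988Convergent, (2.19) p.258] -/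
theorem factor219 (O : TkOps ι M) {k : ℕ} (hL : O.Laws k) (l : List (Set ι)) (hne : l ≠ [])
    (hZ : l.foldr (· ∪ ·) (∅ : Set ι) = O.Z k) (hdis : l.Pairwise Disjoint) :
    O.T k (O.Z k) = (l.map (O.T k)).prod := by
  have hsub : ∀ X ∈ l, X ⊆ O.Z k := fun X hX x hx => hZ ▸ mem_unionL.mpr ⟨X, hX, hx⟩
  rw [← hZ]
  exact factor219_list O hL l hne hsub hdis

/-- The operations of pairwise disjoint sub-regions of `Z_k` pairwise commute (*"The operations corresponding to disjoint
regions commute"*), as a `List.Pairwise Commute` statement on the list of factors. [cite: Balaban1988Convergent, (2.19) p.258] -/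
theorem pairwise_commute (O : TkOps ι M) {k : ℕ} (hL : O.Laws k) :
    ∀ (l : List (Set ι)), (∀ X ∈ l, X ⊆ O.Z k) → l.Pairwise Disjoint → (l.map (O.T k)).Pairwise Commute
  | [], _, _ => by simp
  | X :: l, hsub, hdis => by
    rw [List.map_cons, List.pairwise_cons]
    refine ⟨?_, pairwise_commute O hL l (fun W hW => hsub W (List.mem_cons_of_mem X hW)) (List.pairwise_cons.mp hdis).2⟩
    intro b hb
    obtain ⟨W, hW, rfl⟩ := List.mem_map.mp hb
    exact hL.comm219 X W (hsub X (by simp)) (hsub W (List.mem_cons_of_mem X hW)) ((List.pairwise_cons.mp hdis).1 W hW)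

/-- **Order independence of the product in (2.19).**  For pairwise disjoint sub-regions of `Z_k`, any reordering of the
factors gives the same product `Π 𝐓_k(X_i)` — the unordered product symbol of (2.19) is legitimate. [cite: Balaban1988Convergent, (2.19) p.258] -/
theorem prod_perm (O : TkOps ι M) {k : ℕ} (hL : O.Laws k) {l l' : List (Set ι)} (hp : l.Perm l')
    (hsub : ∀ X ∈ l, X ⊆ O.Z k) (hdis : l.Pairwise Disjoint) :
    (l.map (O.T k)).prod = (l'.map (O.T k)).prod :=
  (hp.map (O.T k)).prod_eq' (pairwise_commute O hL l hsub hdis)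

/-- (2.19) for any ORDERING of a disjoint decomposition of `Z_k`: `𝐓_k(Z_k) = Π_i 𝐓_k(X_{σ(i)})`. [cite: Balaban1988Convergent, (2.19) p.258] -/
theorem factor219_perm (O : TkOps ι M) {k : ℕ} (hL : O.Laws k) (l l' : List (Set ι)) (hne : l ≠ [])
    (hZ : l.foldr (· ∪ ·) (∅ : Set ι) = O.Z k) (hdis : l.Pairwise Disjoint) (hp : l.Perm l') :
    O.T k (O.Z k) = (l'.map (O.T k)).prod := by
  have hsub : ∀ X ∈ l, X ⊆ O.Z k := fun X hX x hx => hZ ▸ mem_unionL.mpr ⟨X, hX, hx⟩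
  rw [factor219 O hL l hne hZ hdis, prod_perm O hL hp hsub hdis]

end Literature.MathematicalPhysics.QuantumFieldTheory.Balaban1983to89.B14.Eq219Factorization
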